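import Mathlib
import Literature.MathematicalPhysics.QuantumLattice.YangMillsClassical
import Literature.MathematicalPhysics.QuantumLattice.GrassmannIntegralProofs
import Summits.QuantumFields.QCD.Theorems.NestedDissectionSeaEarlyCrosserLawStubKatoSobolevCutoff
import Summits.QuantumFields.QCD.Theorems.NestedDissectionSeaEarlyCrosserLawZeroModeRegularity
import Summits.QuantumFields.QCD.Theorems.NestedDissectionSeaEarlyCrosserLawZeroModePointwise
import Summits.QuantumFields.QCD.Theorems.NestedDissectionSeaEarlyCrosserLawZeroModeClifford
import Summits.QuantumFields.QCD.Theorems.NestedDissectionSeaEarlyCrosserLawZeroModeDuality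
import Summits.QuantumFields.QCD.Theorems.NestedDissectionSeaEarlyCrosserLawZeroModeCutoff
import Summits.QuantumFields.QCD.Theorems.NestedDissectionSeaEarlyCrosserLawZeroModeEnergy
import Summits.QuantumFields.QCD.Theorems.NestedDissectionSeaEarlyCrosserLawZeroModeCurvTerm
import Summits.QuantumFields.QCD.Theorems.NestedDissectionSeaEarlyCrosserLawZeroModeFloorLemmas
import HarnessLib

/-!
# Stub `stub_floorAssembly` of line `zero-mode-floor-dilute-gas` — the zero-mode action floor, assembled
(crux `Summit.QuantumFields.QCD.Theses.NestedDissectionSea.EarlyCrosserLaw`, item stmt-QuantumFields-13995; lead c7)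

GIVEN the pointwise Weitzenböck divergence identity (the statement of the landed stub
`stub_weitzenbockDivergence`) and the cut-off Kato–Sobolev bound (the conclusion of the landed stub
`stub_katoSobolevCutoff`), both verbatim as hypotheses, we prove the ZERO-MODE ACTION FLOOR with
`κ = 1/2`: a smooth anti-Hermitian (traceless) connection `A` on flat `ℝ⁴` with finite coordinate-frame
Yang–Mills action `S = ∫ ρ`, zero topological charge `∫ q = 0`, carrying a smooth square-integrable
somewhere-nonzero Dirac-harmonic spinor field `ψ`, has `S ≥ (1/2)·8π²` (indeed `S ≥ 50π²/9`).

Proof (all constants explicit).  Suppose `S < 50π²/9`.  Pointwise, chirality and the Clifford bound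
(`re_inner_cliffordCurvature_le`) give `W := Re⟨ψ,𝔉ψ⟩ ≤ g₁|ψ₊|² + g₂|ψ₋|²` with
`gᵢ² = 3 Σ_a‖F^∓_a‖² = 3(ρ ± 2q)` (duality identities, anti-Hermiticity of `F`), so `∫ gᵢ² = 3S`.
For every smooth compactly supported cut-off `χ`: the Bochner trick (`dirichlet_bound`) gives
`X − ∫χ²W ≤ δX + δ⁻¹E` and the curvature-term bound (`curvature_term_bound`) gives
`∫χ²W ≤ √(3S)(√6/8π)[(1+θ)(4/5)X + (1+θ⁻¹)E]`, where `X = ∫χ²|∇ψ|²`, `E = ∫‖dχ‖²|ψ|²`;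
`α := √(3S)(√6/8π)(4/5) < 1` exactly when `S < 50π²/9`, and the choice `θ = (1−α)/2`,
`δ = (1−(1+θ)α)/2 > 0` yields `δX ≤ K·E` (`floor_absorb`, file `…ZeroModeFloorLemmas.lean`).  With the cut-off family of
`exists_cutoff_family` (`χ_R = 1` on `B_R`, `‖dχ_R‖ ≤ C/R`), `E ≤ C²‖ψ‖₂²/R²`, so `∫χ₀²|∇ψ|² ≤ ∫χ_R²|∇ψ|² → 0`
for any fixed cut-off `χ₀`; hence `∇ψ ≡ 0`, so `d|ψ|² = 2Re⟨ψ,∇ψ⟩ = 0`, `|ψ|²` is a positive constant —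
not integrable on `ℝ⁴`.  Contradiction.  Hence `S ≥ 50π²/9 ≥ 4π² = (1/2)·8π²`.
-/

noncomputable section

open scoped BigOperators Matrix ContDiff Matrix.Norms.Frobenius
open MeasureTheory Literature.MathematicalPhysics.QuantumLattice

namespace Summit.QuantumFields.QCD.Cruxes.EarlyCrosserLaw.ZeroModeFloorDiluteGas

/-! ### The registered stub -/

/-- **S2g `stub_floorAssembly` (registered stub of line `zero-mode-floor-dilute-gas`, lead c7): the zero-mode
action floor from the Weitzenböck divergence identity (S2e) and the cut-off Kato–Sobolev bound (S2f's
conclusion).**  `κ = 1/2`; see the module docstring for the proof. -/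
theorem stub_floorAssembly :
    (∀ (A : Connection (EuclideanSpace ℝ (Fin 4)) (Matrix (Fin 3) (Fin 3) ℂ)) (ψ : EuclideanSpace ℝ (Fin 4) → Fin 4 → Fin 3 → ℂ), IsSmoothConnection A → (∀ x v, (A x v)ᴴ = -(A x v)) → ContDiff ℝ ((⊤ : ℕ∞) : WithTop ℕ∞) ψ → (∀ x s c, ∑ μ : Fin 4, ∑ s' : Fin 4, euclideanGamma μ s s' * (fderiv ℝ (fun y => ψ y s' c) x (EuclideanSpace.single μ (1 : ℝ)) + ∑ c' : Fin 3, A x (EuclideanSpace.single μ (1 : ℝ)) c c' * ψ x s' c') = 0) → ∀ x : EuclideanSpace ℝ (Fin 4), ∑ μ : Fin 4, fderiv ℝ (fun y => (∑ s, ∑ c, starRingEnd ℂ (ψ y s c) * (fderiv ℝ (fun z => ψ z s c) y (EuclideanSpace.single μ (1 : ℝ)) + ∑ c' : Fin 3, A y (EuclideanSpace.single μ (1 : ℝ)) c c' * ψ y s c')).re) x (EuclideanSpace.single μ (1 : ℝ)) = (∑ μ : Fin 4, ∑ s, ∑ c, ‖fderiv ℝ (fun z => ψ z s c) x (EuclideanSpace.single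 μ (1 : ℝ)) + ∑ c' : Fin 3, A x (EuclideanSpace.single μ (1 : ℝ)) c c' * ψ x s c'‖ ^ 2) - (∑ s, ∑ c, starRingEnd ℂ (ψ x s c) * (∑ μ : Fin 4, ∑ ν : Fin 4, if μ < ν then ∑ s' : Fin 4, (euclideanGamma μ * euclideanGamma ν) s s' * ∑ c' : Fin 3, curvature A x (EuclideanSpace.single μ (1 : ℝ)) (EuclideanSpace.single ν (1 : ℝ)) c c' * ψ x s' c' else 0)).re) →
    (∀ (A : Connection (EuclideanSpace ℝ (Fin 4)) (Matrix (Fin 3) (Fin 3) ℂ)) (ψ : EuclideanSpace ℝ (Fin 4) → Fin 4 → Fin 3 → ℂ) (χ : EuclideanSpace ℝ (Fin 4) → ℝ) (θ : ℝ), IsSmoothConnection A → (∀ x v, (A x v)ᴴ = -(A x v)) → ContDiff ℝ ((⊤ : ℕ∞) : WithTop ℕ∞) ψ → (∀ x s c, ∑ μ : Fin 4, ∑ s' : Fin 4, euclideanGamma μ s s' * (fderiv ℝ (fun y => ψ y s' c) x (EuclideanSpace.single μ (1 : ℝ)) + ∑ c' : Fin 3, A x (EuclideanSpace.single μ (1 :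 ℝ)) c c' * ψ x s' c') = 0) → ContDiff ℝ ((⊤ : ℕ∞) : WithTop ℕ∞) χ → HasCompactSupport χ → 0 < θ → Real.sqrt (∫ x, χ x ^ 4 * (∑ s, ∑ c, ‖ψ x s c‖ ^ 2) ^ 2) ≤ (Real.sqrt 6 / (8 * Real.pi)) * ((1 + θ) * (4 / 5 : ℝ) * (∫ x, χ x ^ 2 * (∑ μ : Fin 4, ∑ s, ∑ c, ‖fderiv ℝ (fun z => ψ z s c) x (EuclideanSpace.single μ (1 : ℝ)) + ∑ c' : Fin 3, A x (EuclideanSpace.single μ (1 : ℝ)) c c' * ψ x s c'‖ ^ 2)) + (1 + θ⁻¹) * (∫ x, ‖fderiv ℝ χ x‖ ^ 2 * (∑ s, ∑ c, ‖ψ x s c‖ ^ 2)))) →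
    ∃ κ : ℝ, 4 / 9 < κ ∧ ∀ (A : Connection (EuclideanSpace ℝ (Fin 4)) (Matrix (Fin 3) (Fin 3) ℂ)) (ψ : EuclideanSpace ℝ (Fin 4) → Fin 4 → Fin 3 → ℂ), IsSmoothConnection A → (∀ x v, (A x v)ᴴ = -(A x v) ∧ (A x v).trace = 0) → Integrable (ymDensityOfBasis (EuclideanSpace.basisFun (Fin 4) ℝ) A) → Integrable (fun x => (((curvature A x (EuclideanSpace.single (0 : Fin 4) (1 : ℝ)) (EuclideanSpace.single (1 : Fin 4) (1 : ℝ))) * (curvature A x (EuclideanSpace.single (2 : Fin 4) (1 : ℝ)) (EuclideanSpace.single (3 : Fin 4) (1 : ℝ)))).trace - ((curvature A x (EuclideanSpace.single (0 : Fin 4) (1 : ℝ)) (EuclideanSpace.single (2 : Fin 4) (1 : ℝ))) * (curvature A x (EuclideanSpace.single (1 : Fin 4) (1 : ℝ)) (EuclideanSpace.single (3 : Fin 4) (1 : ℝ)))).trace + ((curvature A x (EuclideanSpace.single (0 : Fin 4) (1 : ℝ)) (EuclideanSpace.single (3 : Fin 4) (1 : ℝ))) * (curvature A x (EuclideanSpace.single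 (1 : Fin 4) (1 : ℝ)) (EuclideanSpace.single (2 : Fin 4) (1 : ℝ)))).trace).re) → ∫ x, (fun x => (((curvature A x (EuclideanSpace.single (0 : Fin 4) (1 : ℝ)) (EuclideanSpace.single (1 : Fin 4) (1 : ℝ))) * (curvature A x (EuclideanSpace.single (2 : Fin 4) (1 : ℝ)) (EuclideanSpace.single (3 : Fin 4) (1 : ℝ)))).trace - ((curvature A x (EuclideanSpace.single (0 : Fin 4) (1 : ℝ)) (EuclideanSpace.single (2 : Fin 4) (1 : ℝ))) * (curvature A x (EuclideanSpace.single (1 : Fin 4) (1 : ℝ)) (EuclideanSpace.single (3 : Fin 4) (1 : ℝ)))).trace + ((curvature A x (EuclideanSpace.single (0 : Fin 4) (1 : ℝ)) (EuclideanSpace.single (3 : Fin 4) (1 : ℝ))) * (curvature A x (EuclideanSpace.single (1 : Fin 4) (1 : ℝ)) (EuclideanSpace.single (2 : Fin 4) (1 : ℝ)))).trace).re) x = 0 → ContDiff ℝ ((⊤ : ℕ∞) : WithTop ℕ∞) ψ → Integrable (fun x => ∑ s, ∑ c, ‖ψ x s c‖ ^ 2) → (∃ x, ψ x ≠ 0)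 → (∀ x s c, ∑ μ : Fin 4, ∑ s' : Fin 4, euclideanGamma μ s s' * (fderiv ℝ (fun y => ψ y s' c) x (EuclideanSpace.single μ (1 : ℝ)) + ∑ c' : Fin 3, A x (EuclideanSpace.single μ (1 : ℝ)) c c' * ψ x s' c') = 0) → κ * (8 * Real.pi ^ 2) ≤ ∫ x, ymDensityOfBasis (EuclideanSpace.basisFun (Fin 4) ℝ) A x := by
  intro hW hKS
  refine ⟨1 / 2, by norm_num, ?_⟩
  intro A ψ hA hAH hρi hqi hq0 hψ hn2 hne hD
  have hAH' : ∀ x v, (A x v)ᴴ = -(A x v) := fun x v => (hAH x v).1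
  -- names for the densities
  set ρ : EuclideanSpace ℝ (Fin 4) → ℝ := ymDensityOfBasis (EuclideanSpace.basisFun (Fin 4) ℝ) A with hρdef
  set q : EuclideanSpace ℝ (Fin 4) → ℝ := fun x => (((curvature A x (EuclideanSpace.single (0 : Fin 4) (1 : ℝ)) (EuclideanSpace.single (1 : Fin 4) (1 : ℝ))) * (curvature A x (EuclideanSpace.single (2 : Fin 4) (1 : ℝ)) (EuclideanSpace.single (3 : Fin 4) (1 : ℝ)))).trace - ((curvature A x (EuclideanSpace.single (0 : Fin 4) (1 : ℝ)) (EuclideanSpace.single (2 : Fin 4) (1 : ℝ))) * (curvature A x (EuclideanSpace.single (1 : Fin 4) (1 : ℝ)) (EuclideanSpace.single (3 : Fin 4) (1 : ℝ)))).trace + ((curvature A x (EuclideanSpace.single (0 : Fin 4) (1 : ℝ)) (EuclideanSpace.single (3 : Fin 4) (1 : ℝ))) * (curvature A x (EuclideanSpace.single (1 : Fin 4) (1 : ℝ)) (EuclideanSpace.single (2 : Fin 4) (1 : ℝ)))).trace).re with hqdef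
  set n : EuclideanSpace ℝ (Fin 4) → ℝ := fun x => ∑ s, ∑ c, ‖ψ x s c‖ ^ 2 with hndef
  set G : EuclideanSpace ℝ (Fin 4) → ℝ := fun x => ∑ μ : Fin 4, ∑ s, ∑ c,
    ‖fderiv ℝ (fun z => ψ z s c) x (EuclideanSpace.single μ (1 : ℝ)) +
      ∑ c' : Fin 3, A x (EuclideanSpace.single μ (1 : ℝ)) c c' * ψ x s c'‖ ^ 2 with hGdef
  set W : EuclideanSpace ℝ (Fin 4) → ℝ := fun x => (∑ s, ∑ c, starRingEnd ℂ (ψ x s c) *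
    (∑ μ : Fin 4, ∑ ν : Fin 4, if μ < ν then ∑ s' : Fin 4, (euclideanGamma μ * euclideanGamma ν) s s' *
      ∑ c' : Fin 3, curvature A x (EuclideanSpace.single μ (1 : ℝ)) (EuclideanSpace.single ν (1 : ℝ)) c c' * ψ x s' c'
      else 0)).re with hWdef
  have hqi' : Integrable q := hqi
  have hq0' : ∫ x, q x = 0 := hq0
  have hρi' : Integrable ρ := hρi
  -- the Weitzenböck divergence identity for our data, and continuity of the curvature term
  have hdiv : ∀ x : EuclideanSpace ℝ (Fin 4), ∑ μ : Fin 4, fderiv ℝ (fun y => (∑ s, ∑ c, starRingEnd ℂ (ψ y s c) *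
      (fderiv ℝ (fun z => ψ z s c) y (EuclideanSpace.single μ (1 : ℝ)) +
        ∑ c' : Fin 3, A y (EuclideanSpace.single μ (1 : ℝ)) c c' * ψ y s c')).re) x (EuclideanSpace.single μ (1 : ℝ))
      = G x - W x :=
    hW A ψ hA hAH' hψ hD
  have hWc : Continuous W := continuous_of_weitzenbock A ψ hA hψ W hdiv
  -- basic facts on `n`, `G`, `ρ`
  have hn0 : ∀ x, 0 ≤ n x := fun x => Finset.sum_nonneg fun s _ => Finset.sum_nonneg fun c _ => sq_nonneg _
  have hGnn : ∀ x, 0 ≤ G x := fun x =>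
    Finset.sum_nonneg fun μ _ => Finset.sum_nonneg fun s _ => Finset.sum_nonneg fun c _ => sq_nonneg _
  have hnc : Continuous n := continuous_finsetSum _ fun s _ => continuous_finsetSum _ fun c _ =>
    ((contDiff_spinor_component hψ s c).continuous.norm).pow 2
  have hGc : Continuous G := continuous_finsetSum _ fun μ _ => continuous_finsetSum _ fun s _ =>
    continuous_finsetSum _ fun c _ => ((contDiff_covDeriv_component hA hψ μ s c).continuous.norm).pow 2
  have hS0 : 0 ≤ ∫ x, ρ x := integral_nonneg fun x => ymDensityOfBasis_nonneg _ A x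
  -- Suppose, for contradiction, that the action is below the floor.
  by_contra hlt
  have hπ2 : 0 < Real.pi ^ 2 := by positivity
  have hSlt : (∫ x, ρ x) < 50 * Real.pi ^ 2 / 9 := by
    push Not at hlt
    linarith
  -- the curvature weights
  set g₁ : EuclideanSpace ℝ (Fin 4) → ℝ := fun x => Real.sqrt 3 * Real.sqrt (‖curvature A x (EuclideanSpace.single (0 : Fin 4) (1 : ℝ)) (EuclideanSpace.single (1 : Fin 4) (1 : ℝ)) - curvature A x (EuclideanSpace.single (2 : Fin 4) (1 : ℝ)) (EuclideanSpace.single (3 : Fin 4) (1 : ℝ))‖ ^ 2 + ‖curvature A x (EuclideanSpace.single (0 : Fin 4) (1 : ℝ)) (EuclideanSpace.single (2 : Fin 4) (1 : ℝ)) + curvature A x (EuclideanSpace.single (1 : Fin 4) (1 : ℝ)) (EuclideanSpace.single (3 : Fin 4) (1 : ℝ))‖ ^ 2 + ‖curvature A x (EuclideanSpace.single (0 : Fin 4) (1 : ℝ)) (EuclideanSpace.single (3 : Fin 4) (1 : ℝ)) - curvature A x (EuclideanSpace.single (1 : Fin 4) (1 : ℝ)) (EuclideanSpace.single (2 : Fin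 4) (1 : ℝ))‖ ^ 2) with hg₁def
  set g₂ : EuclideanSpace ℝ (Fin 4) → ℝ := fun x => Real.sqrt 3 * Real.sqrt (‖curvature A x (EuclideanSpace.single (0 : Fin 4) (1 : ℝ)) (EuclideanSpace.single (1 : Fin 4) (1 : ℝ)) + curvature A x (EuclideanSpace.single (2 : Fin 4) (1 : ℝ)) (EuclideanSpace.single (3 : Fin 4) (1 : ℝ))‖ ^ 2 + ‖curvature A x (EuclideanSpace.single (0 : Fin 4) (1 : ℝ)) (EuclideanSpace.single (2 : Fin 4) (1 : ℝ)) - curvature A x (EuclideanSpace.single (1 : Fin 4) (1 : ℝ)) (EuclideanSpace.single (3 : Fin 4) (1 : ℝ))‖ ^ 2 + ‖curvature A x (EuclideanSpace.single (0 : Fin 4) (1 : ℝ)) (EuclideanSpace.single (3 : Fin 4) (1 : ℝ)) + curvature A x (EuclideanSpace.single (1 : Fin 4) (1 : ℝ)) (EuclideanSpace.single (2 : Fin 4) (1 : ℝ))‖ ^ 2) with hg₂def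
  have hFc : ∀ μ ν : Fin 4, Continuous fun x =>
      curvature A x (EuclideanSpace.single μ (1 : ℝ)) (EuclideanSpace.single ν (1 : ℝ)) :=
    fun μ ν => continuous_curvature hA _ _
  have hg₁c : Continuous g₁ := continuous_const.mul
    ((((((hFc 0 1).sub (hFc 2 3)).norm.pow 2).add (((hFc 0 2).add (hFc 1 3)).norm.pow 2)).add
      (((hFc 0 3).sub (hFc 1 2)).norm.pow 2)).sqrt)
  have hg₂c : Continuous g₂ := continuous_const.mul
    ((((((hFc 0 1).add (hFc 2 3)).norm.pow 2).add (((hFc 0 2).sub (hFc 1 3)).norm.pow 2)).add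
      (((hFc 0 3).add (hFc 1 2)).norm.pow 2)).sqrt)
  have hg₁0 : ∀ x, 0 ≤ g₁ x := fun x => mul_nonneg (Real.sqrt_nonneg _) (Real.sqrt_nonneg _)
  have hg₂0 : ∀ x, 0 ≤ g₂ x := fun x => mul_nonneg (Real.sqrt_nonneg _) (Real.sqrt_nonneg _)
  have hgsq₁ : ∀ x, g₁ x ^ 2 = 3 * (ρ x + 2 * q x) := fun x => gUpper_sq hA hAH' x
  have hgsq₂ : ∀ x, g₂ x ^ 2 = 3 * (ρ x - 2 * q x) := fun x => gLower_sq hA hAH' x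
  have hg₁i : Integrable (fun x => g₁ x ^ 2) := by
    refine ((hρi'.add (hqi'.const_mul 2)).const_mul 3).congr (ae_of_all _ fun x => ?_)
    show 3 * (ρ x + 2 * q x) = g₁ x ^ 2
    exact (hgsq₁ x).symm
  have hg₂i : Integrable (fun x => g₂ x ^ 2) := by
    refine ((hρi'.sub (hqi'.const_mul 2)).const_mul 3).congr (ae_of_all _ fun x => ?_)
    show 3 * (ρ x - 2 * q x) = g₂ x ^ 2
    exact (hgsq₂ x).symm
  have hI₁ : ∫ x, g₁ x ^ 2 = 3 * ∫ x, ρ x := by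
    have h : (fun x => g₁ x ^ 2) =ᵐ[volume] fun x => 3 * (ρ x + 2 * q x) := ae_of_all _ fun x => hgsq₁ x
    rw [integral_congr_ae h, integral_const_mul, integral_add hρi' (hqi'.const_mul 2), integral_const_mul, hq0']
    ring
  have hI₂ : ∫ x, g₂ x ^ 2 = 3 * ∫ x, ρ x := by
    have h : (fun x => g₂ x ^ 2) =ᵐ[volume] fun x => 3 * (ρ x - 2 * q x) := ae_of_all _ fun x => hgsq₂ x
    rw [integral_congr_ae h, integral_const_mul, integral_sub hρi' (hqi'.const_mul 2), integral_const_mul, hq0']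
    ring
  set T : ℝ := Real.sqrt (3 * ∫ x, ρ x) with hTdef
  have hT : 0 ≤ T := Real.sqrt_nonneg _
  have hT2 : T ^ 2 = 3 * ∫ x, ρ x := by rw [hTdef]; exact Real.sq_sqrt (mul_nonneg (by norm_num) hS0)
  have hg₁T : ∫ x, g₁ x ^ 2 ≤ T ^ 2 := by rw [hT2, hI₁]
  have hg₂T : ∫ x, g₂ x ^ 2 ≤ T ^ 2 := by rw [hT2, hI₂]
  -- `α < 1` exactly because `S < 50π²/9`
  have hα : T * (Real.sqrt 6 / (8 * Real.pi)) * (4 / 5 : ℝ) < 1 := by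
    have hπ : 0 < Real.pi := Real.pi_pos
    have hπne : Real.pi ≠ 0 := Real.pi_ne_zero
    have h18 : 3 * (∫ x, ρ x) * 6 < (10 * Real.pi) ^ 2 := by nlinarith
    have hT6 : T * Real.sqrt 6 < 10 * Real.pi := by
      rw [hTdef, ← Real.sqrt_mul (mul_nonneg (by norm_num) hS0) 6]
      exact (Real.sqrt_lt' (by positivity)).2 h18
    have hrew : T * (Real.sqrt 6 / (8 * Real.pi)) * (4 / 5 : ℝ) = T * Real.sqrt 6 / (10 * Real.pi) := by
      field_simp
      ring
    rw [hrew, div_lt_one (by positivity)]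
    exact hT6
  -- absorption constants
  obtain ⟨θ, δ, K, hθ, hδ, hK, habs⟩ := floor_absorb T (Real.sqrt 6 / (8 * Real.pi)) hT (by positivity) hα
  -- the pointwise chirality/Clifford bound on the curvature term
  have hWle : ∀ x, W x ≤ g₁ x * (∑ c : Fin 3, (‖ψ x 0 c‖ ^ 2 + ‖ψ x 1 c‖ ^ 2)) +
      g₂ x * (∑ c : Fin 3, (‖ψ x 2 c‖ ^ 2 + ‖ψ x 3 c‖ ^ 2)) := fun x =>
    re_inner_cliffordCurvature_le
      (fun μ ν => curvature A x (EuclideanSpace.single μ (1 : ℝ)) (EuclideanSpace.single ν (1 : ℝ))) (ψ x)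
  -- the key inequality `δ X_χ ≤ K E_χ` for every smooth compactly supported test function `χ`
  have key : ∀ χ : EuclideanSpace ℝ (Fin 4) → ℝ, ContDiff ℝ ∞ χ → HasCompactSupport χ →
      δ * (∫ x, χ x ^ 2 * G x) ≤ K * ∫ x, ‖fderiv ℝ χ x‖ ^ 2 * n x := by
    intro χ hχ hχs
    have h1 := dirichlet_bound A ψ hA hψ W hdiv χ hχ hχs δ hδ
    have h2 := curvature_term_bound hKS A ψ hA hAH' hψ hD W g₁ g₂ hWc hg₁c hg₂c hg₁0 hg₂0 hg₁i hg₂i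
      T hT hg₁T hg₂T hWle χ hχ hχs θ hθ
    exact habs _ _ _ h1 h2
  -- the cut-off family
  obtain ⟨C, hC, hfam⟩ := exists_cutoff_family
  set N : ℝ := ∫ x, n x with hNdef
  have hN0 : 0 ≤ N := integral_nonneg fun x => hn0 x
  set M : ℝ := K * C ^ 2 * N / δ with hMdef
  have hM0 : 0 ≤ M := by rw [hMdef]; positivity
  -- Step: the covariant gradient vanishes identically
  have hGzero : ∀ x₀, G x₀ = 0 := by
    intro x₀
    obtain ⟨χ₀, hχ₀, hχ₀s, hχ₀1, hχ₀0, hχ₀le, -⟩ := hfam (‖x₀‖ + 1) (by positivity)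
    have iX₀ : Integrable fun x => χ₀ x ^ 2 * G x :=
      ((hχ₀.continuous.pow 2).mul hGc).integrable_of_hasCompactSupport (hasCompactSupport_sq_mul hχ₀s G)
    obtain ⟨R', hR'⟩ := (Metric.isBounded_iff_subset_closedBall (0 : EuclideanSpace ℝ (Fin 4))).1
      hχ₀s.isCompact.isBounded
    set X₀ : ℝ := ∫ x, χ₀ x ^ 2 * G x with hX₀def
    have hX₀0 : 0 ≤ X₀ := integral_nonneg fun x => mul_nonneg (sq_nonneg _) (hGnn x)
    -- `X₀ ≤ M / R` for every large `R`
    have hX₀bound : ∀ R : ℝ, 1 ≤ R → R' ≤ R → X₀ ≤ M / R := by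
      intro R h1R hR'R
      have hRpos : 0 < R := by linarith
      obtain ⟨χ, hχ, hχs, hχ1, hχ0, hχle, hdχ⟩ := hfam R hRpos
      have hk := key χ hχ hχs
      have iE : Integrable fun x => ‖fderiv ℝ χ x‖ ^ 2 * n x :=
        (((hχ.continuous_fderiv (by simp)).norm.pow 2).mul hnc).integrable_of_hasCompactSupport
          (hasCompactSupport_normFDeriv_sq_mul hχs n)
      have hE : ∫ x, ‖fderiv ℝ χ x‖ ^ 2 * n x ≤ (C / R) ^ 2 * N := by
        have h := integral_mono iE (hn2.const_mul ((C / R) ^ 2)) fun x =>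
          mul_le_mul_of_nonneg_right (pow_le_pow_left₀ (norm_nonneg _) (hdχ x) 2) (hn0 x)
        rwa [integral_const_mul] at h
      have iXχ : Integrable fun x => χ x ^ 2 * G x :=
        ((hχ.continuous.pow 2).mul hGc).integrable_of_hasCompactSupport (hasCompactSupport_sq_mul hχs G)
      have hX₀χ : X₀ ≤ ∫ x, χ x ^ 2 * G x := by
        refine integral_mono iX₀ iXχ fun x => ?_
        have hχx : χ₀ x ^ 2 ≤ χ x ^ 2 := by
          by_cases hx : x ∈ tsupport χ₀
          · have hxR : ‖x‖ ≤ R := le_trans (mem_closedBall_zero_iff.1 (hR' hx)) hR'R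
            rw [hχ1 x hxR]
            nlinarith [hχ₀0 x, hχ₀le x]
          · rw [image_eq_zero_of_notMem_tsupport hx]
            nlinarith [sq_nonneg (χ x)]
        exact mul_le_mul_of_nonneg_right hχx (hGnn x)
      have hXχ : (∫ x, χ x ^ 2 * G x) ≤ M / R ^ 2 := by
        have hR2 : 0 < R ^ 2 := by positivity
        have h3 : δ * (∫ x, χ x ^ 2 * G x) ≤ K * ((C / R) ^ 2 * N) :=
          hk.trans (mul_le_mul_of_nonneg_left hE hK)
        rw [le_div_iff₀ hR2, hMdef, le_div_iff₀ hδ]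
        calc (∫ x, χ x ^ 2 * G x) * R ^ 2 * δ = (δ * ∫ x, χ x ^ 2 * G x) * R ^ 2 := by ring
          _ ≤ K * ((C / R) ^ 2 * N) * R ^ 2 := mul_le_mul_of_nonneg_right h3 hR2.le
          _ = K * C ^ 2 * N := by field_simp
      calc X₀ ≤ ∫ x, χ x ^ 2 * G x := hX₀χ
        _ ≤ M / R ^ 2 := hXχ
        _ ≤ M / R := by
            apply div_le_div_of_nonneg_left hM0 hRpos
            nlinarith
    have hX₀le : X₀ ≤ 0 := by
      by_contra hpos
      push Not at hpos
      set R : ℝ := max (max R' 1) (2 * M / X₀ + 1) with hRdef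
      have h1R : 1 ≤ R := le_trans (le_max_right _ _) (le_max_left _ _)
      have hR'R : R' ≤ R := le_trans (le_max_left _ _) (le_max_left _ _)
      have hR2 : 2 * M / X₀ + 1 ≤ R := le_max_right _ _
      have hRpos : 0 < R := by linarith
      have hb := hX₀bound R h1R hR'R
      rw [le_div_iff₀ hRpos] at hb
      have hm : X₀ * (2 * M / X₀ + 1) ≤ X₀ * R := mul_le_mul_of_nonneg_left hR2 hX₀0
      have h' : X₀ * (2 * M / X₀ + 1) = 2 * M + X₀ := by
        field_simp
      linarith
    have hX₀ : X₀ = 0 := le_antisymm hX₀le hX₀0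
    by_contra hGx
    have hpos : 0 < X₀ := by
      rw [hX₀def]
      refine ((hχ₀.continuous.pow 2).mul hGc).integral_pos_of_hasCompactSupport_nonneg_nonzero
        (hasCompactSupport_sq_mul hχ₀s G) (fun x => mul_nonneg (sq_nonneg _) (hGnn x)) (x := x₀) ?_
      rw [hχ₀1 x₀ (by linarith [norm_nonneg x₀])]
      simpa using hGx
    linarith
  -- each covariant-derivative component vanishes
  have hcov0 : ∀ (x : EuclideanSpace ℝ (Fin 4)) (μ : Fin 4) (s : Fin 4) (c : Fin 3),
      fderiv ℝ (fun z => ψ z s c) x (EuclideanSpace.single μ (1 : ℝ)) +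
        ∑ c' : Fin 3, A x (EuclideanSpace.single μ (1 : ℝ)) c c' * ψ x s c' = 0 := by
    intro x μ s c
    have h' : ∑ μ : Fin 4, ∑ s, ∑ c, ‖fderiv ℝ (fun z => ψ z s c) x (EuclideanSpace.single μ (1 : ℝ)) +
        ∑ c' : Fin 3, A x (EuclideanSpace.single μ (1 : ℝ)) c c' * ψ x s c'‖ ^ 2 = 0 := hGzero x
    have hμ := (Finset.sum_eq_zero_iff_of_nonneg (fun μ _ =>
      Finset.sum_nonneg fun s _ => Finset.sum_nonneg fun c _ => sq_nonneg _)).1 h' μ (Finset.mem_univ _)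
    have hs := (Finset.sum_eq_zero_iff_of_nonneg (fun s _ =>
      Finset.sum_nonneg fun c _ => sq_nonneg _)).1 hμ s (Finset.mem_univ _)
    have hc := (Finset.sum_eq_zero_iff_of_nonneg (fun c _ => sq_nonneg _)).1 hs c (Finset.mem_univ _)
    exact norm_eq_zero.1 ((pow_eq_zero_iff two_ne_zero).1 hc)
  -- … so ψ vanishes identically (covariantly constant and square-integrable), contradiction
  obtain ⟨x₁, hx₁⟩ := hne
  exact hx₁ (spinor_eq_zero_of_covDeriv_eq_zero A ψ hAH' hψ hcov0 hn2 x₁)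

end Summit.QuantumFields.QCD.Cruxes.EarlyCrosserLaw.ZeroModeFloorDiluteGas

end
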